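import Summits.BirchSwinnertonDyer.BirchSwinnertonDyer.Theorems.ClassRecordThreeEulerHalvesAtThreeAuxInertLevelStabilizer
import Summits.BirchSwinnertonDyer.BirchSwinnertonDyer.Theorems.ClassRecordThreeEulerHalvesAtThreeAuxInertLevelOrder
import Literature.NumberTheory.EllipticCurves.Rank1Residual.Predicates
import Literature.NumberTheory.EllipticCurves.GlobalMinimalModel
import HarnessLib

/-!
# `stub_auxiliaryInertLevelAtThree` reduced to the Chebotarev supply (crux 19109, line `inert`)

Crux `stmt-BirchSwinnertonDyer-19109` (`EulerHalvesAtThree`), line `inert` (tam3-p1 g18, skeleton r17/r18),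
registered stub `stub_auxiliaryInertLevelAtThree`.  The companions
`…AuxInertLevelStabilizer` (p646235: Galois side — the stabiliser of `w̃` in `G_{ℓ₀}` has order
`ord[𝔭_v]_{ℓ₀m₀} / ord[𝔭_v]_{m₀}`) and `…AuxInertLevelOrder` (p647278: ideal side —
`3^e · ord[𝔭_v]_{m₀} ∣ ord[𝔭_v]_{ℓ₀m₀}` from the order of a generator `β` of `𝔭_v^A` modulo `ℓ₀`) are
assembled here: **the registered stub follows from ONE hypothesis `hCheb`, the Chebotarev supply**
(`stub_auxiliaryInertLevelAtThree_of_chebotarevSupply`, whose conclusion is the stub's signature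
verbatim).  `hCheb` is the only remaining non-kernel content of the stub: for `W` with `ρ̄_{E,3}` onto,
`K` imaginary quadratic with `d_K < −4`, `q` split, `𝔮 ∋ q`, `A, t ≥ 1`, `𝔮^A (t) = (β)`, a finite set
`S` and `e ≥ 0`, a prime `ℓ ∉ S`, inert in `K`, with `3 ∤ a_ℓ(E)` and
`∀ d, (∃ a ∈ ℤ, β^d ≡ a (mod ℓ𝓞_K)) → 3^e ∣ d` — a Frobenius condition in
`M = K(μ_{3^{e+k}}, E[3], γ₀^{1/3})/ℚ` (`β/β̄ = γ₀^{3^k}`, `γ₀ ∉ K^{×3}`), non-empty because complex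
conjugation composed with a Kummer generator over `K(μ_{3^{e+k}})` and a commutator of lifts of
`GL₂(F_3)` (every element of `SL₂(F_3)` is a commutator; for every involution `r` of determinant `−1`
and every `u ∈ SL₂(F_3)` one of `s ∈ {(1 1;0 1), (1 0;1 1), (2 1;1 1)}` has `tr(r u^j s) = 0` for at most
one `j ∈ ℤ/3`) realises the class (hand-verified; STUB-PLAN evidence on the crux item).

* `ncard_primesOver_eq_one_of_isPrime_span` — an inert `(q)` is the only prime over `q`;
* `stub_auxiliaryInertLevelAtThree_of_chebotarevSupply` — the reduction.

HONEST FRAMING: a CONDITIONAL reduction (hypothesis `hCheb` explicit); the crux stays open; BSD is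
proved for no curve here.

## References

* B. H. Gross, *Kolyvagin's work on modular elliptic curves*, LMS LNS 153 (1991), §3. [GrossLMS1991]
* D. A. Cox, *Primes of the form x² + ny²*, 2nd ed. (2013), §5.B Prop. 5.16, §7.D (7.27), §9.A. [Cox2013]
* J. Neukirch, *Algebraic Number Theory* (1999), Ch. VII §13 Thm. (13.4). [NeukirchANT1999]
* D. A. Marcus, *Number Fields*, 2nd ed. (2018), Ch. 3, Thm. 25. [Marcus2018]

## Mathlib / tree search

Tree (imported, reused by name): `AuxInertLevel.auxiliaryInertLevel_conclusion_of_orderOf_dvd`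
(`…AuxInertLevelStabilizer`); `AuxInertLevel.mul_orderOf_primeClass_dvd`, `exists_pow_mul_span_eq_span`,
`not_span_le_of_natCast_mem`, `forall_mul_orderOf_dvd_of_one` (`…AuxInertLevelOrder`);
`Rank1Residual.Surj` (`Rank1Residual/Predicates`); `WeierstrassCurve.frobeniusTrace` (`GlobalMinimalModel`);
`ringClassField`, `ringClassGalOver` (`HeegnerPointsOfConductor`); `finite_ringClassGroup` (`RingClassNumber`).
Mathlib: `Set.ncard_eq_one`, `Set.nonempty_of_ncard_ne_zero`, `PrincipalIdealRing.isMaximal_of_irreducible`,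
`isOfFinOrder_of_finite`, `Irreducible.coprime_iff_not_dvd`.
`lean search 'auxiliaryInertLevel|AuxiliaryInertLevel'` (2026-08-28): only the line's skeleton and
bsd-idea-9's `Lines/aux_norm_receptacle.lean` (crux workfiles, not importable).
-/

noncomputable section

set_option autoImplicit false
set_option linter.dupNamespace false

open scoped nonZeroDivisors NumberField Pointwise Classical
open IsDedekindDomain IsDedekindDomain.HeightOneSpectrum Module NumberField WeierstrassCurve

namespace Summit.BirchSwinnertonDyer.BirchSwinnertonDyer.Theorems.AuxInertLevel

open Literature.NumberTheory.EllipticCurves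
open Literature.NumberTheory.NumberFields Literature.NumberTheory.NumberFields.RingClassField
open Literature.NumberTheory.QuadraticFields.RingClass
open Literature.NumberTheory.EllipticCurves.Rank1Residual

variable {K : Type} [Field K] [NumberField K]

/-- **An inert prime has exactly one prime above it**: if `(q) = q𝓞_K` is prime then it is the only
prime of `𝓞_K` over `qℤ` (so a prime with two primes above it, `ncard = 2`, is not inert — used to
separate the split carrier `q` from the inert level primes). [cite: Cox2013, §5.B Prop. 5.16; Marcus2018, Ch. 3, Thm. 25] -/
theorem ncard_primesOver_eq_one_of_isPrime_span {q : ℕ} (hq : q.Prime)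
    (hP : (Ideal.span {(q : 𝓞 K)}).IsPrime) :
    ((Ideal.span {(q : ℤ)}).primesOver (𝓞 K)).ncard = 1 := by
  rw [Set.ncard_eq_one]
  refine ⟨Ideal.span {(q : 𝓞 K)}, Set.eq_singleton_iff_unique_mem.mpr ⟨?_, ?_⟩⟩
  · refine ⟨hP, ⟨?_⟩⟩
    have hmax : (Ideal.span {(q : ℤ)}).IsMaximal :=
      PrincipalIdealRing.isMaximal_of_irreducible (Nat.prime_iff_prime_int.mp hq).irreducible
    refine (hmax.eq_of_le (Ideal.IsPrime.under ℤ _).ne_top ?_)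
    rw [Ideal.span_singleton_le_iff_mem, Ideal.under_def, Ideal.mem_comap, map_natCast]
    exact Ideal.mem_span_singleton_self _
  · rintro P ⟨hPp, hPo⟩
    have hq0 : Ideal.span {(q : 𝓞 K)} ≠ ⊥ := by
      rw [Ne, Ideal.span_singleton_eq_bot]; exact_mod_cast hq.ne_zero
    haveI := hPp
    have hle : Ideal.span {(q : 𝓞 K)} ≤ P := by
      rw [Ideal.span_singleton_le_iff_mem]
      have : ((q : ℤ) : 𝓞 K) ∈ P := by
        have h := hPo.over ▸ (Ideal.mem_span_singleton_self (q : ℤ))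
        rw [Ideal.mem_comap] at h
        simpa using h
      simpa using this
    exact ((Ideal.IsPrime.isMaximal hP hq0).eq_of_le hPp.ne_top hle).symm

/-- **`stub_auxiliaryInertLevelAtThree` from the Chebotarev supply.**  The registered stub of line
`inert` (crux 19109; = bsd-idea-9 g8's `AuxiliaryInertLevel W K ι 3 q N`) — for every exponent `e` and
guarded level `m₀` an auxiliary inert prime `ℓ₀ ∤ N m₀` with `3 ∤ a_{ℓ₀}(E)` such that every generator
`σ` of `G_{ℓ₀} = Gal(K[ℓ₀m₀]/K[m₀])` has `σ^{ℓ₀+1} = 1` and `3^e ∣ #Stab_{⟨σ⟩}(w̃)` for all `w̃ ∋ q` —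
FOLLOWS from the single analytic input `hCheb` (the CHEBOTAREV SUPPLY: for the generator `β` of
`𝔮^A` up to `ℚ^×` and any finite set `S` of primes, an inert prime `ℓ ∉ S` with `3 ∤ a_ℓ(E)` modulo
which the multiplicative order of `β` in `(𝓞_K/ℓ)^×/F_ℓ^×` is divisible by `3^e`, phrased as
`∀ d, (∃ a ∈ ℤ, β^d ≡ a (mod ℓ𝓞_K)) → 3^e ∣ d`).  Assembly: `q ∤ m₀` (level primes inert, `q` split:
`ncard_primesOver_eq_one_of_isPrime_span`); `𝔮 ∋ q`; `A = ord[𝔮]_{m₀}`, `𝔮^A (t) = (β)`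
(`exists_pow_mul_span_eq_span`); `hCheb` with `S = ` prime factors of `N m₀ t` and `q` gives `ℓ₀`;
then `mul_orderOf_primeClass_dvd` (ideal side), `forall_mul_orderOf_dvd_of_one` (both primes above
`q`) and `auxiliaryInertLevel_conclusion_of_orderOf_dvd` (Galois side).  The conclusion after the
binder `hCheb` is the registered stub signature VERBATIM.  HONEST FRAMING: conditional on `hCheb`
(hand-verified in the line's STUB-PLAN: Frobenius density in `K(μ_{3^{e+k}}, E[3], γ₀^{1/3})/ℚ`,
`β/β̄ = γ₀^{3^k}`; not yet in the kernel); the crux stays open; BSD is proved for no curve.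
[cite: GrossLMS1991, §3 (pp. 238–239)] [cite: Cox2013, §7.D (7.27), §9.A] [cite: NeukirchANT1999, Ch. VII §13 Thm. (13.4) (Chebotarev)] -/
theorem stub_auxiliaryInertLevelAtThree_of_chebotarevSupply
    (hCheb : ∀ (W : WeierstrassCurve ℚ) [W.IsElliptic] [W.IsGloballyMinimal] (K : Type) [Field K]
      [NumberField K], IsImaginaryQuadratic K → NumberField.discr K < -4 → Surj W 3 →
      ∀ (q : ℕ), q.Prime → ((Ideal.span {(q : ℤ)}).primesOver (𝓞 K)).ncard = 2 →
      ∀ (v : HeightOneSpectrum (𝓞 K)), (q : 𝓞 K) ∈ v.asIdeal →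
      ∀ (A : ℕ), 0 < A → ∀ (t : ℤ), 0 < t → ∀ (β : 𝓞 K),
        v.asIdeal ^ A * Ideal.span {(t : 𝓞 K)} = Ideal.span {β} →
      ∀ (S : Finset ℕ) (e : ℕ), ∃ ℓ : ℕ, ℓ.Prime ∧ ℓ ∉ S ∧ (Ideal.span {(ℓ : 𝓞 K)}).IsPrime ∧
        ¬ (3 : ℤ) ∣ W.frobeniusTrace ℓ ∧
        ∀ d : ℕ, (∃ a : ℤ, β ^ d - (a : 𝓞 K) ∈ Ideal.span {(ℓ : 𝓞 K)}) → 3 ^ e ∣ d) :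
    ∀ (W : WeierstrassCurve ℚ) [W.IsElliptic] [W.IsGloballyMinimal] (K : Type) [Field K] [NumberField K] (ι : K →+* ℂ)
      [∀ j : ℕ, NumberField (ringClassField K ι j)],
      IsImaginaryQuadratic K → NumberField.discr K < -4 → Surj W 3 →
      ∀ (q N : ℕ) [Fact q.Prime], ((Ideal.span {(q : ℤ)}).primesOver (𝓞 K)).ncard = 2 → N ≠ 0 →
      ∀ e m₀ : ℕ, Squarefree m₀ → (∀ r ∈ m₀.primeFactors, ¬ r ∣ N ∧ (Ideal.span {(r : 𝓞 K)}).IsPrime) →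
        ∃ ℓ₀ : ℕ, ℓ₀.Prime ∧ ¬ ℓ₀ ∣ N ∧ ¬ ℓ₀ ∣ m₀ ∧ (Ideal.span {(ℓ₀ : 𝓞 K)}).IsPrime ∧
          ¬ (3 : ℤ) ∣ W.frobeniusTrace ℓ₀ ∧
          ∀ σ : ringClassField K ι (ℓ₀ * m₀) ≃ₐ[ℚ] ringClassField K ι (ℓ₀ * m₀),
            Subgroup.zpowers σ = ringClassGalOver ι (ℓ₀ * m₀) m₀ →
            σ ^ (ℓ₀ + 1) = 1 ∧
            ∀ w : HeightOneSpectrum (𝓞 (ringClassField K ι (ℓ₀ * m₀))),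
              ((q : ℕ) : 𝓞 (ringClassField K ι (ℓ₀ * m₀))) ∈ w.asIdeal →
              3 ^ e ∣ Nat.card (MulAction.stabilizer (Subgroup.zpowers σ) w.asIdeal) := by
  intro W _ _ K _ _ ι _ hK hD hsurj q N _ hq2 hN e m₀ hm₀ hgood
  have hq : q.Prime := Fact.out
  have hm₀0 : m₀ ≠ 0 := Squarefree.ne_zero hm₀
  -- `q ∤ m₀`: the prime factors of `m₀` are inert, `q` is split
  have hqm₀ : q.Coprime m₀ := by
    rw [Nat.Prime.coprime_iff_not_dvd hq]
    intro hdvd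
    have hmem : q ∈ m₀.primeFactors := Nat.mem_primeFactors.mpr ⟨hq, hdvd, hm₀0⟩
    have h1 := ncard_primesOver_eq_one_of_isPrime_span (K := K) hq (hgood q hmem).2
    omega
  -- a prime `v₀ ∋ q` of `K`
  obtain ⟨P, hP⟩ : ((Ideal.span {(q : ℤ)}).primesOver (𝓞 K)).Nonempty :=
    Set.nonempty_of_ncard_ne_zero (by rw [hq2]; norm_num)
  obtain ⟨hPp, hPo⟩ := hP
  have hqP : (q : 𝓞 K) ∈ P := by
    have h := hPo.over ▸ (Ideal.mem_span_singleton_self (q : ℤ))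
    rw [Ideal.mem_comap] at h
    simpa using h
  have hP0 : P ≠ ⊥ := fun h => by
    rw [h, Ideal.mem_bot] at hqP
    exact hq.ne_zero (by exact_mod_cast hqP)
  set v₀ : HeightOneSpectrum (𝓞 K) := ⟨P, hPp, hP0⟩ with hv₀def
  have hqv₀ : (q : 𝓞 K) ∈ v₀.asIdeal := hqP
  -- `A = ord[𝔮]_{m₀}` and the generator `β`
  haveI : Finite (RingClassGroup K m₀) := finite_ringClassGroup (K := K) (f := m₀) hK.1 hm₀0
  have hv₀m : ¬ Ideal.span {(m₀ : 𝓞 K)} ≤ v₀.asIdeal := not_span_le_of_natCast_mem hqm₀ hqv₀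
  have hA1 : primeClass m₀ v₀ ^ orderOf (primeClass m₀ v₀) = 1 := pow_orderOf_eq_one _
  have hApos : 0 < orderOf (primeClass m₀ v₀) := (isOfFinOrder_of_finite (primeClass m₀ v₀)).orderOf_pos
  obtain ⟨β, t, ht0, htm, hβ⟩ := exists_pow_mul_span_eq_span hK m₀ hv₀m hA1
  -- Chebotarev
  obtain ⟨ℓ₀, hℓ₀, hℓ₀S, hℓ₀P, haℓ₀, hDℓ₀⟩ := hCheb W K hK hD hsurj q hq hq2 v₀ hqv₀ _ hApos t ht0 β hβ
    (N.primeFactors ∪ m₀.primeFactors ∪ t.natAbs.primeFactors ∪ {q}) e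
  simp only [Finset.mem_union, Finset.mem_singleton, Nat.mem_primeFactors, not_or, not_and] at hℓ₀S
  obtain ⟨⟨⟨hℓ₀N, hℓ₀m₀⟩, hℓ₀t⟩, hℓ₀q⟩ := hℓ₀S
  have hℓ₀N' : ¬ ℓ₀ ∣ N := fun h => hℓ₀N hℓ₀ h hN
  have hℓ₀m₀' : ¬ ℓ₀ ∣ m₀ := fun h => hℓ₀m₀ hℓ₀ h hm₀0
  have hℓ₀t' : ¬ (ℓ₀ : ℤ) ∣ t := fun h => hℓ₀t hℓ₀ (Int.natAbs_dvd_natAbs.mpr h |>.trans (by simp))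
    (Int.natAbs_ne_zero.mpr ht0.ne')
  refine ⟨ℓ₀, hℓ₀, hℓ₀N', hℓ₀m₀', hℓ₀P, haℓ₀, fun σ hσ => ?_⟩
  -- coprimalities
  have hqℓ₀ : q.Coprime ℓ₀ := (Nat.coprime_primes hq hℓ₀).mpr (fun h => hℓ₀q h.symm)
  have hqn : q.Coprime (ℓ₀ * m₀) := Nat.Coprime.mul_right hqℓ₀ hqm₀
  have htn : IsCoprime t ((ℓ₀ * m₀ : ℕ) : ℤ) := by
    rw [Nat.cast_mul]
    refine IsCoprime.mul_right ?_ htm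
    exact ((Nat.prime_iff_prime_int.mp hℓ₀).irreducible.coprime_iff_not_dvd.mpr hℓ₀t').symm
  have hv₀n : ¬ Ideal.span {((ℓ₀ * m₀ : ℕ) : 𝓞 K)} ≤ v₀.asIdeal := not_span_le_of_natCast_mem hqn hqv₀
  have hord₀ := mul_orderOf_primeClass_dvd hK hD hℓ₀ hv₀n hA1 htn hβ (hDℓ₀)
  exact auxiliaryInertLevel_conclusion_of_orderOf_dvd hK ι hℓ₀ hℓ₀P hℓ₀m₀' hm₀0 hq hqn
    (forall_mul_orderOf_dvd_of_one hK hq hqm₀ hqn hqv₀ hord₀) σ hσ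

end Summit.BirchSwinnertonDyer.BirchSwinnertonDyer.Theorems.AuxInertLevel

end
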